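import Literature.Analysis.InverseSpectral.KreinStringWeylLimit
import HarnessLib

/-!
# Kreĭn strings: analyticity in the spectral parameter and properties of `q_S`

* `differentiable_phi`, `differentiable_psi`: for fixed `x ∈ [0, L)`, `z ↦ φ(x, z)` and
  `z ↦ ψ(x, z)` are entire (the Picard series are power series in `z` with infinite radius);
* `isOpen_offNonnegAxis` and `differentiableOn_psi_div_phi`: the finite-depth Weyl quotients
  `q_x = ψ(x,·)/φ(x,·)` are holomorphic on `ℂ ∖ [0, ∞)`;
* properties of the principal Titchmarsh–Weyl function `q_S = lim q_x` of a string other than the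
  free half-line: conjugation symmetry `q_S(conj z) = conj q_S(z)` (`conj_principalWeylFunction`),
  the Herglotz sign `Im q_S(z) · Im z ≥ 0` (`im_principalWeylFunction_mul_im_nonneg`) and positivity
  on the negative axis (`tendsto_principalWeylFunction_of_neg` in `KreinStringWeylNeg`).

These are the function-theoretic properties making `q_S` a Stieltjes function (Kac–Kreĭn 1974 §2);
the integral representation `q_S ∈ N_S` additionally needs the Herglotz–Stieltjes representation
theorem.

## References

KacKrein1974 (§§1–2), DymMcKean1976 (Ch. 5).
-/

open MeasureTheory Filter Set Topology Metric
open scoped ENNReal Nat ComplexConjugate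

noncomputable section

namespace Literature.Analysis.InverseSpectral

/-- `ℂ ∖ [0, ∞)` is open. [folklore] -/
theorem isOpen_offNonnegAxis : IsOpen offNonnegAxis :=
  (isOpen_ne_fun Complex.continuous_im continuous_const).union
    (isOpen_lt Complex.continuous_re continuous_const)

/-- `ℂ ∖ [0, ∞)` is stable under conjugation. [folklore] -/
theorem conj_mem_offNonnegAxis {z : ℂ} (hz : z ∈ offNonnegAxis) : conj z ∈ offNonnegAxis := by
  rcases hz with h | h
  · exact Or.inl (by simpa using h)
  · exact Or.inr (by simpa using h)

namespace KreinString

variable (S : KreinString)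

/-- The Picard series in the spectral parameter: `z ↦ ∑ₙ (-z)ⁿ (Kⁿf)(x)` is entire for
`x ∈ [0, L)` and continuous `f`. [folklore] -/
theorem differentiable_picardSeries {f : ℝ → ℝ} (hf : Continuous f) {x : ℝ} (hx : x ∈ S.dom) :
    Differentiable ℂ (fun z => ∑' n, (-z) ^ n * (S.picard f n x : ℂ)) := by
  intro z₀
  obtain ⟨C, hC⟩ := isCompact_Icc.exists_bound_of_continuousOn (hf.continuousOn (s := Icc 0 x))
  have hC' : ∀ t ∈ Icc 0 x, |f t| ≤ C := fun t ht => by simpa [Real.norm_eq_abs] using hC t ht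
  have hC0 : 0 ≤ C := (abs_nonneg _).trans (hC' 0 ⟨le_rfl, hx.1⟩)
  set R := ‖z₀‖ + 1 with hR
  set Mx := (S.massMeasure (Icc 0 x)).toReal with hMx
  have hMx0 : 0 ≤ Mx := ENNReal.toReal_nonneg
  have hdiff : DifferentiableOn ℂ (fun z => ∑' n, (-z) ^ n * (S.picard f n x : ℂ)) (ball 0 R) := by
    refine Complex.differentiableOn_tsum_of_summable_norm
      (u := fun n => C * (R * Mx * x) ^ n / n !)
      ((Real.summable_pow_div_factorial (R * Mx * x)).mul_left C |>.congr fun n => by ring)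
      (fun n => ((differentiable_id.neg.pow n).mul (differentiable_const _)).differentiableOn)
      isOpen_ball (fun n w hw => ?_)
    rw [norm_mul, norm_pow, norm_neg, Complex.norm_real, Real.norm_eq_abs]
    have hw' : ‖w‖ ≤ R := (mem_ball_zero_iff.1 hw).le
    calc ‖w‖ ^ n * |S.picard f n x| ≤ R ^ n * (C * (Mx * x) ^ n / n !) := by
          gcongr
          exact S.abs_picard_le hx hC' n ⟨hx.1, le_rfl⟩
      _ = C * (R * Mx * x) ^ n / n ! := by rw [mul_pow, mul_pow, mul_pow]; ring
  exact hdiff.differentiableAt (isOpen_ball.mem_nhds (by simp [hR]))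

/-- `z ↦ φ(x, z)` is entire for `x ∈ [0, L)`. [folklore] -/
theorem differentiable_phi {x : ℝ} (hx : x ∈ S.dom) : Differentiable ℂ (fun z => S.phi z x) := by
  have h := S.differentiable_picardSeries continuous_const hx (f := fun _ => (1 : ℝ))
  simpa [phi_eq] using h

/-- `z ↦ ψ(x, z)` is entire for `x ∈ [0, L)`. [folklore] -/
theorem differentiable_psi {x : ℝ} (hx : x ∈ S.dom) : Differentiable ℂ (fun z => S.psi z x) := by
  have h := S.differentiable_picardSeries continuous_id hx (f := fun t => t)
  simpa [psi_eq] using h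

/-- The finite-depth Weyl quotient `z ↦ ψ(x,z)/φ(x,z)` is holomorphic on `ℂ ∖ [0, ∞)`.
[cite: KacKrein1974, §2] -/
theorem differentiableOn_psi_div_phi {x : ℝ} (hx : x ∈ S.dom) :
    DifferentiableOn ℂ (fun z => S.psi z x / S.phi z x) offNonnegAxis := fun z hz =>
  (((S.differentiable_psi hx) z).div ((S.differentiable_phi hx) z)
    (S.phi_ne_zero_of_mem_offNonnegAxis hz hx)).differentiableWithinAt

/-- Conjugation symmetry of the principal Titchmarsh–Weyl function: `q_S(conj z) = conj q_S(z)` for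
`z ∈ ℂ ∖ [0, ∞)` and a string other than the free half-line. [folklore] -/
theorem conj_principalWeylFunction (hS : ¬ S.IsTrivial) {z : ℂ} (hz : z ∈ offNonnegAxis) :
    S.principalWeylFunction (conj z) = conj (S.principalWeylFunction z) := by
  haveI := S.toEnd_neBot
  have h := S.tendsto_principalWeylFunction hS hz
  have hc : Tendsto (fun x => S.psi (conj z) x / S.phi (conj z) x) S.toEnd
      (𝓝 (conj (S.principalWeylFunction z))) := by
    have := (Complex.continuous_conj.tendsto _).comp h
    refine this.congr (fun x => ?_)
    simp only [Function.comp_apply, map_div₀, S.conj_phi, S.conj_psi]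
  exact tendsto_nhds_unique (S.tendsto_principalWeylFunction hS (conj_mem_offNonnegAxis hz)) hc

/-- The principal Titchmarsh–Weyl function is real on the negative axis. [folklore] -/
theorem im_principalWeylFunction_of_neg (hS : ¬ S.IsTrivial) {z : ℂ} (hz : z.im = 0)
    (hz' : z.re < 0) : (S.principalWeylFunction z).im = 0 :=
  (S.tendsto_principalWeylFunction_of_neg hS hz hz').2.2

/-- **Herglotz sign of `q_S`**: `Im q_S(z) · Im z ≥ 0` for `z ∈ ℂ ∖ [0, ∞)`, for every string other
than the free half-line (limit of `im_psi_div_phi_mul_im_nonneg`). [cite: KacKrein1974, §2] -/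
theorem im_principalWeylFunction_mul_im_nonneg (hS : ¬ S.IsTrivial) {z : ℂ}
    (hz : z ∈ offNonnegAxis) :
    0 ≤ (S.principalWeylFunction z).im * z.im := by
  by_cases him : z.im = 0
  · simp [him]
  · haveI := S.toEnd_neBot
    have h := S.tendsto_principalWeylFunction hS hz
    have him' : Tendsto (fun x => (S.psi z x / S.phi z x).im * z.im) S.toEnd
        (𝓝 ((S.principalWeylFunction z).im * z.im)) :=
      ((Complex.continuous_im.tendsto _).comp h).mul_const _
    refine ge_of_tendsto him' ?_
    filter_upwards [S.Ici_inter_dom_mem_toEnd S.zero_mem_dom] with x hx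
    exact S.im_psi_div_phi_mul_im_nonneg him hx.1

/-! ### Local uniform control of `φ(u, z)` in the spectral parameter -/

/-- `s ↦ Re φ(x, -s)` is non-decreasing on `[0, ∞)` (`x ∈ [0, L)`). [folklore] -/
lemma phi_neg_re_mono_param {x : ℝ} (hx : x ∈ S.dom) {s s' : ℝ} (hs : 0 ≤ s) (hss' : s ≤ s') :
    (S.phi (-(s : ℂ)) x).re ≤ (S.phi (-(s' : ℂ)) x).re := by
  rw [S.phi_neg_re, S.phi_neg_re]
  refine (S.summable_picard_neg continuous_const s hx).tsum_le_tsum (fun n => ?_)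
    (S.summable_picard_neg continuous_const s' hx)
  exact mul_le_mul_of_nonneg_right (pow_le_pow_left₀ hs hss' n)
    (S.picard_nonneg (fun _ _ => zero_le_one) n hx.1)

/-- Uniform bound: `|φ(u, z)| ≤ Re φ(x, -R)` for `u ∈ [0, x]`, `|z| ≤ R` (`x ∈ [0, L)`).
[folklore] -/
lemma norm_phi_le_phi_neg {x : ℝ} (hx : x ∈ S.dom) {R : ℝ} {z : ℂ} (hz : ‖z‖ ≤ R) {u : ℝ}
    (hu : u ∈ Icc 0 x) : ‖S.phi z u‖ ≤ (S.phi (-(R : ℂ)) x).re := by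
  have hud : u ∈ S.dom := S.Icc_subset_dom hx hu
  calc ‖S.phi z u‖ ≤ (S.phi (-(‖z‖ : ℂ)) u).re := S.norm_phi_le z hud
    _ ≤ (S.phi (-(R : ℂ)) u).re := S.phi_neg_re_mono_param hud (norm_nonneg _) hz
    _ ≤ (S.phi (-(R : ℂ)) x).re := S.monotoneOn_phi_neg_re ((norm_nonneg _).trans hz) hud hx hu.2

/-- **Lipschitz dependence on the spectral parameter**, uniformly in `u ∈ [0, x]`:
`|φ(u, z₁) - φ(u, z₂)| ≤ Re φ(x, -(R+1)) · |z₁ - z₂|` for `|z₁|, |z₂| < R` (Cauchy estimate for the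
entire function `φ(u, ·)` and the bound `|φ(u,w)| ≤ φ(x, -|w|)`). [folklore] -/
theorem norm_phi_sub_phi_le {x : ℝ} (hx : x ∈ S.dom) {R : ℝ} {z₁ z₂ : ℂ} (hz₁ : ‖z₁‖ < R)
    (hz₂ : ‖z₂‖ < R) {u : ℝ} (hu : u ∈ Icc 0 x) :
    ‖S.phi z₁ u - S.phi z₂ u‖ ≤ (S.phi (-((R + 1 : ℝ) : ℂ)) x).re * ‖z₁ - z₂‖ := by
  have hud : u ∈ S.dom := S.Icc_subset_dom hx hu
  have hdiff := S.differentiable_phi hud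
  have hderiv : ∀ z ∈ ball (0 : ℂ) R, ‖deriv (fun w => S.phi w u) z‖ ≤
      (S.phi (-((R + 1 : ℝ) : ℂ)) x).re := by
    intro z hz
    have h := Complex.norm_deriv_le_of_forall_mem_sphere_norm_le (f := fun w => S.phi w u)
      (c := z) one_pos hdiff.diffContOnCl (C := (S.phi (-((R + 1 : ℝ) : ℂ)) x).re)
      (fun w hw => ?_)
    · simpa using h
    · refine S.norm_phi_le_phi_neg hx ?_ hu
      have hwz : ‖w - z‖ = 1 := by
        rw [mem_sphere, dist_eq_norm] at hw
        exact hw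
      calc ‖w‖ = ‖(w - z) + z‖ := by rw [sub_add_cancel]
        _ ≤ ‖w - z‖ + ‖z‖ := norm_add_le _ _
        _ ≤ R + 1 := by rw [hwz]; linarith [(mem_ball_zero_iff.1 hz).le]
  exact (convex_ball (0 : ℂ) R).norm_image_sub_le_of_norm_deriv_le
    (fun z _ => hdiff z) hderiv (mem_ball_zero_iff.2 hz₂) (mem_ball_zero_iff.2 hz₁)

/-- The finite-depth quotient at depth `x ≥ x₀` differs from the one at depth `x₀` by
`∫_{x₀}^{x} φ⁻²`. [folklore] -/
lemma psi_div_phi_eq_add_integral {z : ℂ} (hz : z ∈ offNonnegAxis) {x₀ x : ℝ} (hx₀ : x₀ ∈ S.dom)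
    (hx₀x : x₀ ≤ x) (hx : x ∈ S.dom) :
    S.psi z x / S.phi z x = S.psi z x₀ / S.phi z x₀ + ∫ t in x₀..x, ((S.phi z t) ^ 2)⁻¹ := by
  have hcontIcc : ∀ {a b : ℝ}, 0 ≤ a → b ∈ S.dom →
      ContinuousOn (fun t => ((S.phi z t) ^ 2)⁻¹) (Icc a b) := by
    intro a b ha hb
    have hsub : Icc a b ⊆ S.dom := fun t ht =>
      ⟨ha.trans ht.1, (ENNReal.ofReal_le_ofReal ht.2).trans_lt hb.2⟩
    exact (((S.isSolution_phi z).1.mono hsub).pow 2).inv₀ (fun t ht =>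
      pow_ne_zero 2 (S.phi_ne_zero_of_mem_offNonnegAxis hz (hsub ht)))
  rw [S.psi_div_phi_eq_integral_of_mem_offNonnegAxis hz hx₀,
    S.psi_div_phi_eq_integral_of_mem_offNonnegAxis hz hx,
    ← intervalIntegral.integral_add_adjacent_intervals (b := x₀)
      ((hcontIcc le_rfl hx₀).intervalIntegrable_of_Icc hx₀.1)
      ((hcontIcc hx₀.1 hx).intervalIntegrable_of_Icc hx₀x)]

/-- **Local uniform bound for the finite-depth Weyl quotients.** If the string carries mass on
`[0, x₀]`, then every `z₀ ∈ ℂ ∖ [0, ∞)` has a closed neighbourhood inside `ℂ ∖ [0, ∞)` on which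
`|ψ(x,z)/φ(x,z)| ≤ B` for all `x ∈ [x₀, L)`. [cite: KacKrein1974, §2] -/
theorem exists_uniform_bound_psi_div_phi {x₀ : ℝ} (hx₀ : x₀ ∈ S.dom)
    (hμ : 0 < S.massMeasure (Icc 0 x₀)) {z₀ : ℂ} (hz₀ : z₀ ∈ offNonnegAxis) :
    ∃ r > 0, ∃ B : ℝ, closedBall z₀ r ⊆ offNonnegAxis ∧
      ∀ z ∈ closedBall z₀ r, ∀ x ∈ S.dom, x₀ ≤ x → ‖S.psi z x / S.phi z x‖ ≤ B := by
  -- a ball inside `ℂ ∖ [0,∞)`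
  obtain ⟨r₁, hr₁, hball⟩ := Metric.isOpen_iff.1 isOpen_offNonnegAxis z₀ hz₀
  -- uniform cone constant on `|z - z₀| ≤ c₀/2`
  obtain ⟨c₀, hc₀, hcone⟩ := exists_cone_constant hz₀
  have hcone' : ∀ z, ‖z - z₀‖ ≤ c₀ / 2 → ∀ a b : ℝ, 0 ≤ a → 0 ≤ b →
      c₀ / 2 * (a + b) ≤ ‖(a : ℂ) - z * b‖ := by
    intro z hz a b ha hb
    have h1 := hcone a b ha hb
    have h2 : ‖((a : ℂ) - z₀ * b) - ((a : ℂ) - z * b)‖ ≤ c₀ / 2 * b := by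
      have : ((a : ℂ) - z₀ * b) - ((a : ℂ) - z * b) = (z - z₀) * b := by ring
      rw [this, norm_mul, Complex.norm_real, Real.norm_eq_abs, abs_of_nonneg hb]
      exact mul_le_mul_of_nonneg_right hz hb
    have h3 := norm_sub_norm_le ((a : ℂ) - z₀ * b) ((a : ℂ) - z * b)
    nlinarith
  -- uniform lower bound for `M₀(z) = ∫_{[0,x₀]} |φ(·,z)|² dm`
  have hφc : ContinuousOn (fun u => ‖S.phi z₀ u‖) (Icc 0 x₀) :=
    ((S.isSolution_phi z₀).1.mono (S.Icc_subset_dom hx₀)).norm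
  obtain ⟨u₀, hu₀, hmin⟩ := isCompact_Icc.exists_isMinOn ⟨0, left_mem_Icc.2 hx₀.1⟩ hφc
  set δ := ‖S.phi z₀ u₀‖ with hδ
  have hδ0 : 0 < δ :=
    norm_pos_iff.2 (S.phi_ne_zero_of_mem_offNonnegAxis hz₀ (S.Icc_subset_dom hx₀ hu₀))
  set R := ‖z₀‖ + 1 with hR
  set K := (S.phi (-((R + 1 : ℝ) : ℂ)) x₀).re with hK
  have hK1 : 1 ≤ K := S.one_le_phi_neg_re (by positivity) hx₀
  have hK0 : 0 < K := by linarith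
  -- the radius
  set r := min (min (r₁ / 2) (c₀ / 2)) (min (1 / 2) (δ / (2 * K))) with hr
  have hr0 : 0 < r := by positivity
  have hr_r₁ : r < r₁ := by
    have : r ≤ r₁ / 2 := (min_le_left _ _).trans (min_le_left _ _)
    linarith
  have hr_c : r ≤ c₀ / 2 := (min_le_left _ _).trans (min_le_right _ _)
  have hr_half : r ≤ 1 / 2 := (min_le_right _ _).trans (min_le_left _ _)
  have hr_δ : r ≤ δ / (2 * K) := (min_le_right _ _).trans (min_le_right _ _)
  have hsub : closedBall z₀ r ⊆ offNonnegAxis := (closedBall_subset_ball hr_r₁).trans hball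
  -- lower bound `|φ(u,z)| ≥ δ/2` on `[0,x₀]` for `|z - z₀| ≤ r`
  have hlow : ∀ z, ‖z - z₀‖ ≤ r → ∀ u ∈ Icc 0 x₀, δ / 2 ≤ ‖S.phi z u‖ := by
    intro z hz u hu
    have hz' : ‖z‖ < R := by
      calc ‖z‖ = ‖(z - z₀) + z₀‖ := by rw [sub_add_cancel]
        _ ≤ ‖z - z₀‖ + ‖z₀‖ := norm_add_le _ _
        _ < R := by rw [hR]; linarith
    have hz₀' : ‖z₀‖ < R := by rw [hR]; linarith
    have h1 := S.norm_phi_sub_phi_le hx₀ hz₀' hz' hu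
    have h2 : K * ‖z₀ - z‖ ≤ δ / 2 := by
      rw [norm_sub_rev]
      calc K * ‖z - z₀‖ ≤ K * (δ / (2 * K)) := by gcongr; exact hz.trans hr_δ
        _ = δ / 2 := by field_simp
    have h3 : δ ≤ ‖S.phi z₀ u‖ := hmin hu
    have h4 := norm_sub_norm_le (S.phi z₀ u) (S.phi z u)
    linarith
  have hM : ∀ z, ‖z - z₀‖ ≤ r →
      (δ / 2) ^ 2 * (S.massMeasure (Icc 0 x₀)).toReal ≤
        ∫ u in Icc 0 x₀, ‖S.phi z u‖ ^ 2 ∂S.massMeasure := by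
    intro z hz
    have hcont : ContinuousOn (fun u => ‖S.phi z u‖ ^ 2) (Icc 0 x₀) :=
      (((S.isSolution_phi z).1.mono (S.Icc_subset_dom hx₀)).norm).pow 2
    have hδ2 : 0 ≤ δ / 2 := by positivity
    have h := setIntegral_ge_of_const_le (c := (δ / 2) ^ 2)
      (measurableSet_Icc (a := (0 : ℝ)) (b := x₀)) (S.massMeasure_Icc_lt_top hx₀).ne
      (fun u hu => pow_le_pow_left₀ hδ2 (hlow z hz u hu) 2)
      (S.integrableOn_Icc_of_continuousOn hx₀ hcont)
    rw [smul_eq_mul, measureReal_def, mul_comm] at h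
    exact h
  set m₀ := (δ / 2) ^ 2 * (S.massMeasure (Icc 0 x₀)).toReal with hm₀def
  have hm₀ : 0 < m₀ :=
    mul_pos (by positivity) (ENNReal.toReal_pos hμ.ne' (S.massMeasure_Icc_lt_top hx₀).ne)
  -- bound for `q_{x₀}` on the closed ball (continuity)
  have hq₀c : ContinuousOn (fun z => S.psi z x₀ / S.phi z x₀) (closedBall z₀ r) :=
    (S.differentiableOn_psi_div_phi hx₀).continuousOn.mono hsub
  obtain ⟨B₀, hB₀⟩ := (isCompact_closedBall z₀ r).exists_bound_of_continuousOn hq₀c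
  refine ⟨r, hr0, B₀ + ((c₀ / 2) ^ 2)⁻¹ * m₀⁻¹, hsub, fun z hz x hx hx₀x => ?_⟩
  have hz' : ‖z - z₀‖ ≤ r := by rwa [mem_closedBall, dist_eq_norm] at hz
  have hzU : z ∈ offNonnegAxis := hsub hz
  have hM₀z : 0 < ∫ u in Icc 0 x₀, ‖S.phi z u‖ ^ 2 ∂S.massMeasure :=
    lt_of_lt_of_le hm₀ (hM z hz')
  have htail := S.norm_integral_inv_phi_sq_le hzU (c := c₀ / 2) (by positivity)
    (hcone' z (hz'.trans hr_c)) hx₀.1 le_rfl hx₀x hx hM₀z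
  -- drop the non-negative terms
  have hT0 : ∀ t, 0 ≤ t →
      0 ≤ ∫ s in (0 : ℝ)..t, ‖z * ∫ u in Icc 0 s, S.phi z u ∂S.massMeasure‖ ^ 2 :=
    fun t ht => intervalIntegral.integral_nonneg ht (fun s _ => by positivity)
  have h1 : ((∫ s in (0 : ℝ)..x₀, ‖z * ∫ u in Icc 0 s, S.phi z u ∂S.massMeasure‖ ^ 2) +
      ∫ u in Icc 0 x₀, ‖S.phi z u‖ ^ 2 ∂S.massMeasure)⁻¹ ≤ m₀⁻¹ :=
    inv_anti₀ hm₀ (by linarith [hT0 x₀ hx₀.1, hM z hz'])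
  have h2 : 0 ≤ ((∫ s in (0 : ℝ)..x, ‖z * ∫ u in Icc 0 s, S.phi z u ∂S.massMeasure‖ ^ 2) +
      ∫ u in Icc 0 x₀, ‖S.phi z u‖ ^ 2 ∂S.massMeasure)⁻¹ := by
    have := hT0 x (hx₀.1.trans hx₀x)
    positivity
  rw [S.psi_div_phi_eq_add_integral hzU hx₀ hx₀x hx]
  calc ‖S.psi z x₀ / S.phi z x₀ + ∫ t in x₀..x, ((S.phi z t) ^ 2)⁻¹‖
      ≤ ‖S.psi z x₀ / S.phi z x₀‖ + ‖∫ t in x₀..x, ((S.phi z t) ^ 2)⁻¹‖ := norm_add_le _ _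
    _ ≤ B₀ + ((c₀ / 2) ^ 2)⁻¹ * m₀⁻¹ := by
        refine add_le_add (hB₀ z hz) (htail.trans ?_)
        have hc2 : 0 ≤ ((c₀ / 2) ^ 2)⁻¹ := by positivity
        nlinarith

/-! ### Locally uniform convergence and holomorphy of `q_S` -/

/-- **Equi-Lipschitz bound.** In the situation of `exists_uniform_bound_psi_div_phi` (bound `B` on
`closedBall z₀ r ⊆ ℂ ∖ [0,∞)` for depths `x ≥ x₀`), the quotients `q_x` are `(2B/r)`-Lipschitz on
`ball z₀ (r/2)` (Cauchy estimate). [folklore] -/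
theorem norm_psi_div_phi_sub_le {x₀ : ℝ} {z₀ : ℂ} {r B : ℝ} (hr : 0 < r)
    (hsub : closedBall z₀ r ⊆ offNonnegAxis)
    (hB : ∀ z ∈ closedBall z₀ r, ∀ x ∈ S.dom, x₀ ≤ x → ‖S.psi z x / S.phi z x‖ ≤ B)
    {x : ℝ} (hx : x ∈ S.dom) (hx₀x : x₀ ≤ x) {z₁ z₂ : ℂ} (hz₁ : z₁ ∈ ball z₀ (r / 2))
    (hz₂ : z₂ ∈ ball z₀ (r / 2)) :
    ‖S.psi z₁ x / S.phi z₁ x - S.psi z₂ x / S.phi z₂ x‖ ≤ 2 * B / r * ‖z₁ - z₂‖ := by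
  set f : ℂ → ℂ := fun z => S.psi z x / S.phi z x with hf
  have hdiff : DifferentiableOn ℂ f offNonnegAxis := S.differentiableOn_psi_div_phi hx
  have hderiv : ∀ z ∈ ball z₀ (r / 2), ‖deriv f z‖ ≤ 2 * B / r := by
    intro z hz
    have hcl : closedBall z (r / 2) ⊆ closedBall z₀ r := by
      intro w hw
      rw [mem_closedBall] at hw ⊢
      rw [mem_ball] at hz
      linarith [dist_triangle w z z₀]
    have h := Complex.norm_deriv_le_of_forall_mem_sphere_norm_le (f := f) (c := z) (R := r / 2)
      (C := B) (by positivity)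
      ((hdiff.mono ((closure_ball_subset_closedBall.trans hcl).trans hsub)).diffContOnCl)
      (fun w hw => hB w (hcl (sphere_subset_closedBall hw)) x hx hx₀x)
    calc ‖deriv f z‖ ≤ B / (r / 2) := h
      _ = 2 * B / r := by field_simp
  have hdiffAt : ∀ z ∈ ball z₀ (r / 2), DifferentiableAt ℂ f z := fun z hz =>
    hdiff.differentiableAt (isOpen_offNonnegAxis.mem_nhds (hsub (by
      rw [mem_closedBall]; rw [mem_ball] at hz; linarith)))
  exact (convex_ball z₀ (r / 2)).norm_image_sub_le_of_norm_deriv_le hdiffAt hderiv hz₂ hz₁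

/-- **Locally uniform convergence** of the finite-depth Weyl quotients to `q_S` on `ℂ ∖ [0, ∞)`
(equi-Lipschitz + pointwise convergence). [cite: KacKrein1974, §2] -/
theorem tendstoLocallyUniformlyOn_psi_div_phi (hS : ¬ S.IsTrivial) :
    TendstoLocallyUniformlyOn (fun x z => S.psi z x / S.phi z x) S.principalWeylFunction S.toEnd
      offNonnegAxis := by
  haveI := S.toEnd_neBot
  rw [Metric.tendstoLocallyUniformlyOn_iff]
  intro ε hε z₀ hz₀
  by_cases hmass : ∃ x₀ ∈ S.dom, 0 < S.massMeasure (Icc 0 x₀)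
  · obtain ⟨x₀, hx₀, hμ⟩ := hmass
    obtain ⟨r, hr, B, hsub, hB⟩ := S.exists_uniform_bound_psi_div_phi hx₀ hμ hz₀
    -- Lipschitz constant and mesh
    set Lip := 2 * B / r with hLip
    have hB0 : 0 ≤ B := (norm_nonneg _).trans (hB z₀ (mem_closedBall_self hr.le) x₀ hx₀ le_rfl)
    have hLip0 : 0 ≤ Lip := by positivity
    set η := ε / (3 * (Lip + 1)) with hη
    have hη0 : 0 < η := by positivity
    have hLη : Lip * η ≤ ε / 3 := by
      rw [hη]
      rw [show Lip * (ε / (3 * (Lip + 1))) = ε / 3 * (Lip / (Lip + 1)) by field_simp]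
      exact mul_le_of_le_one_right (by positivity) ((div_le_one (by positivity)).2 (by linarith))
    -- the neighbourhood `closedBall z₀ (r/4)` and a finite `η`-net of it
    have hr4 : 0 < r / 4 := by positivity
    obtain ⟨N, hNsub, hNfin, hNcov⟩ :=
      finite_cover_balls_of_compact (isCompact_closedBall (x := z₀) (r := r / 4)) hη0
    refine ⟨closedBall z₀ (r / 4), mem_nhdsWithin_of_mem_nhds (closedBall_mem_nhds z₀ hr4), ?_⟩
    -- pointwise convergence at the net points, and eventually `x ≥ x₀`
    have hpt : ∀ᶠ x in S.toEnd, ∀ y ∈ N,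
        dist (S.principalWeylFunction y) (S.psi y x / S.phi y x) < ε / 3 := by
      refine (Filter.eventually_all_finite hNfin).2 (fun y hy => ?_)
      have hyU : y ∈ offNonnegAxis := hsub (closedBall_subset_closedBall (by linarith) (hNsub hy))
      have h := (S.tendsto_principalWeylFunction hS hyU)
      rw [Metric.tendsto_nhds] at h
      filter_upwards [h (ε / 3) (by positivity)] with x hx
      rwa [dist_comm] at hx
    have hballs : ∀ {y}, y ∈ closedBall z₀ (r / 4) → y ∈ ball z₀ (r / 2) := fun hy => by
      rw [mem_closedBall] at hy; rw [mem_ball]; linarith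
    -- the limit `q_S` is `Lip`-Lipschitz on `ball z₀ (r/2)` as well
    have hqLip : ∀ {z₁ z₂ : ℂ}, z₁ ∈ ball z₀ (r / 2) → z₂ ∈ ball z₀ (r / 2) →
        ‖S.principalWeylFunction z₁ - S.principalWeylFunction z₂‖ ≤ Lip * ‖z₁ - z₂‖ := by
      intro z₁ z₂ hz₁ hz₂
      have hU : ∀ {w}, w ∈ ball z₀ (r / 2) → w ∈ offNonnegAxis := fun hw =>
        hsub (ball_subset_closedBall (ball_subset_ball (by linarith) hw))
      have h1 := S.tendsto_principalWeylFunction hS (hU hz₁)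
      have h2 := S.tendsto_principalWeylFunction hS (hU hz₂)
      have hlim : Tendsto (fun x => ‖S.psi z₁ x / S.phi z₁ x - S.psi z₂ x / S.phi z₂ x‖) S.toEnd
          (𝓝 ‖S.principalWeylFunction z₁ - S.principalWeylFunction z₂‖) :=
        (h1.sub h2).norm
      refine le_of_tendsto hlim ?_
      filter_upwards [S.Ici_inter_dom_mem_toEnd hx₀] with x hx
      exact S.norm_psi_div_phi_sub_le hr hsub hB hx.1 hx.2 hz₁ hz₂
    filter_upwards [hpt, S.Ici_inter_dom_mem_toEnd hx₀] with x hxN hx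
    intro z hz
    obtain ⟨y, hyN, hzy⟩ : ∃ y ∈ N, z ∈ ball y η := by simpa using hNcov hz
    have hy4 : y ∈ closedBall z₀ (r / 4) := hNsub hyN
    have hzy' : ‖z - y‖ < η := by rwa [mem_ball, dist_eq_norm] at hzy
    have e1 : ‖S.principalWeylFunction z - S.principalWeylFunction y‖ ≤ Lip * η :=
      (hqLip (hballs hz) (hballs hy4)).trans (mul_le_mul_of_nonneg_left hzy'.le hLip0)
    have e2 : ‖S.psi y x / S.phi y x - S.psi z x / S.phi z x‖ ≤ Lip * η := by
      refine (S.norm_psi_div_phi_sub_le hr hsub hB hx.1 hx.2 (hballs hy4) (hballs hz)).trans ?_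
      rw [norm_sub_rev]
      exact mul_le_mul_of_nonneg_left hzy'.le hLip0
    have e3 := hxN y hyN
    rw [dist_eq_norm] at e3 ⊢
    calc ‖S.principalWeylFunction z - S.psi z x / S.phi z x‖
        = ‖(S.principalWeylFunction z - S.principalWeylFunction y) +
            (S.principalWeylFunction y - S.psi y x / S.phi y x) +
            (S.psi y x / S.phi y x - S.psi z x / S.phi z x)‖ := by ring_nf
      _ ≤ ‖S.principalWeylFunction z - S.principalWeylFunction y‖ +
            ‖S.principalWeylFunction y - S.psi y x / S.phi y x‖ +
            ‖S.psi y x / S.phi y x - S.psi z x / S.phi z x‖ := norm_add₃_le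
      _ < ε := by linarith
  · -- no mass below `L`: `q_x = x` on `(0, L)` and `q_S ≡ L`
    push Not at hmass
    have hμ0 : ∀ x ∈ S.dom, S.massMeasure (Icc 0 x) = 0 := fun x hx =>
      nonpos_iff_eq_zero.1 (hmass x hx)
    have hL : S.length ≠ ⊤ := by
      intro hL
      obtain ⟨n, hn⟩ := S.exists_mass_pos hL hS
      rw [S.mass_eq_toReal_Icc, hμ0 n ⟨n.cast_nonneg, by simp [hL]⟩, ENNReal.toReal_zero] at hn
      exact lt_irrefl _ hn
    have hL0 : 0 < S.length.toReal := ENNReal.toReal_pos S.length_pos.ne' hL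
    have hQ : ∀ {z : ℂ}, z ∈ offNonnegAxis → ∀ x ∈ Ioo 0 S.length.toReal,
        S.psi z x / S.phi z x = x := by
      intro z hz x hx
      have hxd : x ∈ S.dom := ⟨hx.1.le, (ENNReal.ofReal_lt_iff_lt_toReal hx.1.le hL).2 hx.2⟩
      rw [S.psi_div_phi_eq_integral_of_mem_offNonnegAxis hz hxd]
      have h1 : EqOn (fun t => ((S.phi z t) ^ 2)⁻¹) (fun _ => (1 : ℂ)) (uIcc 0 x) := by
        intro t ht
        rw [uIcc_of_le hx.1.le] at ht
        simp only
        rw [S.phi_eq_one_of_massMeasure_Icc_eq_zero z (S.Icc_subset_dom hxd ht)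
          (measure_mono_null (Icc_subset_Icc_right ht.2) (hμ0 x hxd))]
        simp
      rw [intervalIntegral.integral_congr h1]
      simp
    have hq : ∀ {z : ℂ}, z ∈ offNonnegAxis → S.principalWeylFunction z = S.length.toReal := by
      intro z hz
      have h := S.tendsto_principalWeylFunction hS hz
      have h2 : Tendsto (fun x => S.psi z x / S.phi z x) S.toEnd (𝓝 (S.length.toReal : ℂ)) := by
        unfold toEnd
        rw [if_neg hL]
        refine Tendsto.congr' ?_
          ((Complex.continuous_ofReal.tendsto _).mono_left nhdsWithin_le_nhds)
        exact mem_of_superset (Ioo_mem_nhdsLT hL0) (fun x hx => (hQ hz x hx).symm)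
      exact tendsto_nhds_unique h h2
    refine ⟨offNonnegAxis, self_mem_nhdsWithin, ?_⟩
    have hev : ∀ᶠ x in S.toEnd, x ∈ Ioo 0 S.length.toReal ∧ dist (S.length.toReal : ℂ) x < ε := by
      have ht : Tendsto (fun x : ℝ => (x : ℂ)) S.toEnd (𝓝 (S.length.toReal : ℂ)) := by
        unfold toEnd
        rw [if_neg hL]
        exact (Complex.continuous_ofReal.tendsto _).mono_left nhdsWithin_le_nhds
      have h1 : ∀ᶠ x in S.toEnd, x ∈ Ioo 0 S.length.toReal := by
        unfold toEnd
        rw [if_neg hL]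
        exact Ioo_mem_nhdsLT hL0
      have h2 := (Metric.tendsto_nhds.1 ht) ε hε
      filter_upwards [h1, h2] with x hx1 hx2
      exact ⟨hx1, by rwa [dist_comm] at hx2⟩
    filter_upwards [hev] with x hx
    intro z hz
    rw [hq hz, hQ hz x hx.1]
    exact hx.2

/-- **`q_S` is holomorphic on `ℂ ∖ [0, ∞)`** for every Kreĭn string other than the free half-line
(locally uniform limit of the holomorphic finite-depth quotients). [cite: KacKrein1974, §2] -/
theorem differentiableOn_principalWeylFunction (hS : ¬ S.IsTrivial) :
    DifferentiableOn ℂ S.principalWeylFunction offNonnegAxis := by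
  haveI := S.toEnd_neBot
  refine (S.tendstoLocallyUniformlyOn_psi_div_phi hS).differentiableOn ?_ isOpen_offNonnegAxis
  filter_upwards [S.Ici_inter_dom_mem_toEnd S.zero_mem_dom] with x hx
  exact S.differentiableOn_psi_div_phi hx.1

end KreinString

end Literature.Analysis.InverseSpectral

end
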